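import Summits.Ventures.CertifiedManyBodySolver.Lower.PauliDoublonLCEn7o8
import Summits.Ventures.CertifiedManyBodySolver.Lower.PauliDoublonLCEU6n7o8
import Summits.Ventures.CertifiedManyBodySolver.Lower.PauliDoublonLCEU12n7o8
import Literature.MathematicalPhysics.QuantumLattice.HubbardTTPrimeBoxTransport
import Summits.Ventures.CertifiedManyBodySolver.Statement
import HarnessLib
import HarnessLib.Audit

/-!
# Pauli–doublon kernel-only floors transported in `t'` — hypothesis-free lower bounds on `energyDensityTT' 1 t' U (7/8)`
# and the first `U`-aware KERNEL-ONLY floor at the cuprate point `(U, n, t') = (8, 7/8, -1/4)`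

hubbard-algo crew (5), seat hubbard-algo-p3 g7 (D-0042 R2(e); `hubbard-algo-p3/TARGET.md` §0 (V6)).  Parts 8–14 of the Pauli–doublon line (seat A's
THEOREM E `PauliDoublon.tlBound_holds` + this seat's LCE majorants; `Lower/PauliDoublonLCE*.lean`, p492287 / p495966 / p495973 …) are KERNEL-ONLY decimal
floors on the nearest-neighbour energy density `energyDensity2D 1 U (7/8)`: `-1.0432` (`U = 8`), `-1.1111` (`U = 6`), `-0.9567` (`U = 12`).  The
Literature's `t'`-transport law `energyDensityTT'_tPrime_transport_ge_decimal` (`e(t,s,U,n) - 1.6212·|s' - s| ≤ e(t,s',U,n)`; `1.6212 > 16/π²`, the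
half-filled diagonal band; [cite: Israel1979, Thm. I.3.4] [cite: LiebLoss1993, §8, Theorem 8.2]) and `energyDensityTT'_zero` carry them to EVERY `t'`
with no new hypothesis:  `L(U) - 1.6212·|t'| ≤ energyDensityTT' 1 t' U (7/8)`.

WHY IT IS WORTH A FILE: at the cuprate point `(8, 7/8, -1/4)` every lower bound in the tree is either a CLAIM NODE (`@[conjecture]`: the externally
certified SDP rows #339 / #352 / #448 / #504, the SDA by-name witnesses of `HubbardAlg/SdaClusterWitnessTT*`) or the `U`-INDEPENDENT kernel-checked
Fermi-sea corner row `HubbardFermiSeaCornerRows.fermiSeaRow_tPrime_neg_one_div_four_density_seven_div_eight : -1.5785817116 ≤ e(1, -1/4, U, 7/8)`.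
The transported Pauli–doublon floor `-1.4485 ≤ e(1, -1/4, 8, 7/8)` is hypothesis-free AND sees `U`: it raises the kernel-only floor at the cuprate point
by `+0.1300` (by `+0.2166` at `U = 12`, by `+0.062` at `U = 6`; at `U = 4` the transported `-1.6187` LOSES to the corner row — the `U`-aware floor pays
off for `U ≳ 5` only).
HONEST FRAMING: first certified bounds; not a superconductivity verdict; CONTEXT class-K floors (`0.614` below the certified lower of record #504
`-0.8341460554` at the cuprate point), not rows; no cell of record moves.  Everything here is a two-line corollary — the content is in the cited files.
-/

noncomputable section

namespace Summit.Ventures.CertifiedManyBodySolver.Lower.PauliDoublon.TPrimeTransport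

open Literature.MathematicalPhysics.QuantumLattice
open Literature.MathematicalPhysics.QuantumLattice.ThermodynamicLimit

/-- **Transport schema** (`U ≥ 0`, `0 ≤ n < 2`): a floor `L ≤ e(t, 0, U, n) = energyDensity2D t U n` gives `L - 1.6212·|t'| ≤ e(t, t', U, n)` for
every `t'`. [cite: Israel1979, Thm. I.3.4] [cite: LiebLoss1993, §8, Theorem 8.2] -/
theorem energyDensityTT'_ge_of_energyDensity2D_ge (t : ℝ) {U : ℝ} (hU : 0 ≤ U) {n : ℝ} (hn0 : 0 ≤ n) (hn2 : n < 2) {L : ℝ}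
    (hL : L ≤ energyDensity2D t U n) (t' : ℝ) : L - 1.6212 * |t'| ≤ energyDensityTT' t t' U n := by
  have h := energyDensityTT'_tPrime_transport_ge_decimal t hU hn0 hn2 0 t'
  rw [energyDensityTT'_zero, sub_zero] at h
  linarith

/-- **Every `t'`, `U = 8`, `n = 7/8` (kernel-only)**: `-1.0432 - 1.6212·|t'| ≤ e(1, t', 8, 7/8)`. -/
theorem energyDensityTT'_one_eight_sevenEighths_ge (t' : ℝ) :
    (-1.0432 : ℝ) - 1.6212 * |t'| ≤ energyDensityTT' 1 t' 8 (7 / 8) :=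
  energyDensityTT'_ge_of_energyDensity2D_ge 1 (by norm_num) (by norm_num) (by norm_num)
    LCEn7o8.energyDensity2D_one_eight_sevenEighths_ge t'

/-- **The cuprate point, kernel-only**: `-1.4485 ≤ e(t = 1, t' = -1/4, U = 8, n = 7/8)` (`= -1.0432 - 1.6212/4`). [cite: XuEtAl2024, eq. (1)] -/
theorem energyDensityTT'_one_negQuarter_eight_sevenEighths_ge : (-1.4485 : ℝ) ≤ energyDensityTT' 1 (-1 / 4) 8 (7 / 8) := by
  have h := energyDensityTT'_one_eight_sevenEighths_ge (-1 / 4)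
  have habs : |(-1 / 4 : ℝ)| = 1 / 4 := by rw [abs_of_neg (by norm_num)]; norm_num
  rw [habs] at h
  linarith

/-- **Cell M3 at `t' = -1/4`, kernel-only**: `M3EnergyLowerRow (-1/4) (-2897/2000)` (`= -1.4485`; Statement.lean §M3) — a hypothesis-free CONTEXT
floor, `0.614` below the claim-node lower of record #504. -/
theorem m3EnergyLowerRow_kernelOnly_tpm1o4 : M3EnergyLowerRow (-1 / 4) (-2897 / 2000) := by
  show (((-2897 / 2000 : ℚ)) : ℝ) ≤ energyDensityTT' 1 (-1 / 4) 8 (7 / 8)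
  have e : (((-2897 / 2000 : ℚ)) : ℝ) = (-1.4485 : ℝ) := by norm_num
  rw [e]
  exact energyDensityTT'_one_negQuarter_eight_sevenEighths_ge

/-- The gain over the `U`-independent kernel-only Fermi-sea corner row at `(t', n) = (-1/4, 7/8)` (`-1.5785817116`,
`HubbardFermiSeaCornerRows.fermiSeaRow_tPrime_neg_one_div_four_density_seven_div_eight`): `+0.1300817116` at `U = 8` (decidable arithmetic). -/
theorem cuprate_kernelOnly_gain : (-1.4485 : ℚ) - (-1.5785817116) = 0.1300817116 := by norm_num

/-- **Every `t'`, `U = 12`, `n = 7/8` (kernel-only)**: `-0.9567 - 1.6212·|t'| ≤ e(1, t', 12, 7/8)`. -/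
theorem energyDensityTT'_one_twelve_sevenEighths_ge (t' : ℝ) :
    (-0.9567 : ℝ) - 1.6212 * |t'| ≤ energyDensityTT' 1 t' 12 (7 / 8) :=
  energyDensityTT'_ge_of_energyDensity2D_ge 1 (by norm_num) (by norm_num) (by norm_num)
    LCEU12n7o8.energyDensity2D_one_twelve_sevenEighths_ge t'

/-- `U = 12`, `t' = -1/4`, kernel-only: `-1.362 ≤ e(1, -1/4, 12, 7/8)` (`+0.2166` over the Fermi-sea corner row). -/
theorem energyDensityTT'_one_negQuarter_twelve_sevenEighths_ge : (-1.362 : ℝ) ≤ energyDensityTT' 1 (-1 / 4) 12 (7 / 8) := by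
  have h := energyDensityTT'_one_twelve_sevenEighths_ge (-1 / 4)
  have habs : |(-1 / 4 : ℝ)| = 1 / 4 := by rw [abs_of_neg (by norm_num)]; norm_num
  rw [habs] at h
  linarith

/-- **Every `t'`, `U = 6`, `n = 7/8` (kernel-only)**: `-1.1111 - 1.6212·|t'| ≤ e(1, t', 6, 7/8)`. -/
theorem energyDensityTT'_one_six_sevenEighths_ge (t' : ℝ) :
    (-1.1111 : ℝ) - 1.6212 * |t'| ≤ energyDensityTT' 1 t' 6 (7 / 8) :=
  energyDensityTT'_ge_of_energyDensity2D_ge 1 (by norm_num) (by norm_num) (by norm_num)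
    LCEU6n7o8.energyDensity2D_one_six_sevenEighths_ge t'

/-- `U = 6`, `t' = -1/4`, kernel-only: `-1.5164 ≤ e(1, -1/4, 6, 7/8)` (`+0.062` over the Fermi-sea corner row). -/
theorem energyDensityTT'_one_negQuarter_six_sevenEighths_ge : (-1.5164 : ℝ) ≤ energyDensityTT' 1 (-1 / 4) 6 (7 / 8) := by
  have h := energyDensityTT'_one_six_sevenEighths_ge (-1 / 4)
  have habs : |(-1 / 4 : ℝ)| = 1 / 4 := by rw [abs_of_neg (by norm_num)]; norm_num
  rw [habs] at h
  linarith

end Summit.Ventures.CertifiedManyBodySolver.Lower.PauliDoublon.TPrimeTransport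

end
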